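import Summits.CriticalPhenomena.PercolationContinuityZ3.Theorems.PercAnnulusCrossingSlabCrossingBridge
import Summits.CriticalPhenomena.PercolationContinuityZ3.Theorems.PercAnnulusCrossingSlabBoxCrossingCriterion
import HarnessLib

/-!
# RSW3 lane (lead GEN 36): THE BRIDGE BETWEEN THE TWO SLAB VOCABULARIES, II — Newman–Tassion–Wu's hypothesis (3.38) of their RSW
# Theorem 3.14 HOLDS AT `p_c(S_k)`, with the absolute constant `1/25`, in the slab-graph (`NTW17`) vocabulary

builds on p205010 (kernel theorem, internal audit signed; external expert review pending) — NOT used in this file.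

Cell `prim-rsw3` (LANE 3), lead seat, gen 36.  Support file (`--supports stmt-CriticalPhenomena-4575`); no definitions, no named
facts, no sorries.  Sequel of `…SlabCrossingBridge.lean` (the identities `P_p^{S_k}[L ⟷ R in [0,m]×[0,h]] = P_p^{ℤ³}(boxCross ![k,m,h] 1)`):
gen 35's Lemma 3.13(ii) `Crossing.le_real_boxCross_slabCritical` (`1/25 ≤ P_{p_c(S_k)}^{ℤ³}(boxCross ![k,n,2n] 1)` for all `k`, `n`)
becomes, for the slab measure on slab configurations used by the `NTW17` port of §3.2–3.3 (`SlabRSWGluing*`, `SlabRSWProp39*`):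

* **`le_real_slabConn_slabCritical`** — `∀ k n, 1/25 ≤ P_{p_c(S_k)}^{S_k}[L ⟷ R in [0,n] × [0,2n]]`, i.e. `inf_n f_{p_c(S_k)}(n,2n) ≥ 1/25`:
  the hypothesis (3.38) of NTW's Theorem 3.14 at the slab critical point, UNIFORMLY IN THE THICKNESS;
* `le_real_slabConn_slabCritical_wide` (heights `h ≥ 2n`), `le_real_slabConn_of_criticalProb_slab_le` (every `p ≥ p_c(S_k)`),
  `le_real_slabConn_bt_slabCritical` (the transposed rectangle `[0,2n] × [0,n]` crossed bottom-to-top).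

References: C. M. Newman, V. Tassion, W. Wu, *Critical percolation and the minimal spanning tree in slabs*, Comm. Pure Appl. Math. 70
(2017) = arXiv:1512.09107, Lemma 3.13, Theorem 3.14 ((3.38)) [NewmanTassionWu2017].
-/

noncomputable section

namespace Summit.CriticalPhenomena.PercolationContinuityZ3.Theorems.Crossing

open MeasureTheory
open Literature.Probability.Percolation Literature.Probability.LatticeModels

/-! ## §3 Newman–Tassion–Wu's hypothesis (3.38) at the slab critical point, in the slab-graph vocabulary -/

/-- **NTW's HYPOTHESIS (3.38) OF THEOREM 3.14 HOLDS AT `p_c(S_k)`, UNIFORMLY IN THE THICKNESS.**  For every `k` and `n`: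
`1/25 ≤ P_{p_c(S_k)}^{S_k}[L ⟷ R in [0,n] × [0,2n]]`, i.e. `inf_n f_{p_c(S_k)}(n,2n) ≥ 1/25` with Newman–Tassion–Wu's `f` read on
the slab graph (gen 35's Lemma 3.13(ii) `le_real_boxCross_slabCritical`, transported by §2).
[cite: NewmanTassionWu2017, Lemma 3.13 and Theorem 3.14 ((3.38))] -/
theorem le_real_slabConn_slabCritical (k n : ℕ) :
    (1 : ℝ) / 25 ≤ (bondPercolation (slabGraph 3 k) (criticalProbIOf (slabGraph 3 k) (slabOrigin 3 k))).real
      (slabConn k (boxR 0 n 0 (2 * n)) {z | z.1 = 0} {z | z.1 = (n : ℤ)}) := by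
  have h := real_slabConn_lr_eq_real_boxCross k n (2 * n) (criticalProbIOf (slabGraph 3 k) (slabOrigin 3 k))
  push_cast at h
  rw [h]
  exact le_real_boxCross_slabCritical k n

/-- **Wide form**: at `p_c(S_k)`, `1/25 ≤ P^{S_k}[L ⟷ R in [0,n] × [0,h]]` for every height `h ≥ 2n`.
[cite: NewmanTassionWu2017, Lemma 3.13] -/
theorem le_real_slabConn_slabCritical_wide (k n : ℕ) {h : ℕ} (hh : 2 * n ≤ h) :
    (1 : ℝ) / 25 ≤ (bondPercolation (slabGraph 3 k) (criticalProbIOf (slabGraph 3 k) (slabOrigin 3 k))).real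
      (slabConn k (boxR 0 n 0 h) {z | z.1 = 0} {z | z.1 = (n : ℤ)}) := by
  rw [real_slabConn_lr_eq_real_boxCross]
  exact le_real_boxCross_slabCritical_wide k n hh

/-- **Above the slab critical point**: for every `p ≥ p_c(S_k)` and every `n`, `1/25 ≤ P_p^{S_k}[L ⟷ R in [0,n] × [0,2n]]`.
[cite: NewmanTassionWu2017, Lemma 3.13] -/
theorem le_real_slabConn_of_criticalProb_slab_le (k n : ℕ) (p : unitInterval)
    (hp : criticalProb (slabGraph 3 k) (slabOrigin 3 k) ≤ (p : ℝ)) :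
    (1 : ℝ) / 25 ≤ (bondPercolation (slabGraph 3 k) p).real
      (slabConn k (boxR 0 n 0 (2 * n)) {z | z.1 = 0} {z | z.1 = (n : ℤ)}) := by
  have h := real_slabConn_lr_eq_real_boxCross k n (2 * n) p
  push_cast at h
  rw [h]
  exact le_real_boxCross_of_criticalProb_slab_le k n p hp

/-- **Transposed form**: at `p_c(S_k)` the rectangle `[0,2n] × [0,n]` is crossed from BOTTOM to TOP with probability `≥ 1/25`
(p2's transposition symmetry `NTW17.real_bt_eq_lr`). [cite: NewmanTassionWu2017, Lemma 3.13] -/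
theorem le_real_slabConn_bt_slabCritical (k n : ℕ) :
    (1 : ℝ) / 25 ≤ (bondPercolation (slabGraph 3 k) (criticalProbIOf (slabGraph 3 k) (slabOrigin 3 k))).real
      (slabConn k (boxR 0 (2 * n) 0 n) {z | z.2 = 0} {z | z.2 = (n : ℤ)}) := by
  rw [NTW17.real_bt_eq_lr]
  exact le_real_slabConn_slabCritical k n

end Summit.CriticalPhenomena.PercolationContinuityZ3.Theorems.Crossing

end
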